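import Summits.Ventures.PercRepro.S1CoreCapSevenThin
import Summits.Ventures.PercRepro.S1CoreCapSevenPlane
import Mathlib.Tactic.IntervalCases

/-!
# PercRepro — TOWARDS `Q*(7) = 19`: NO BIG LINE (p1, gen 26)

The case of 3-point lines only at nullity `7`, with fat points. If no two lines meet, every line is free in every
order and every fat point lies on one line: cap `= #lines + #fat ≤ 7` (`sum_cap_le_seven_of_pairwise_disjoint`).
Otherwise take a PLANE `l` on two meeting lines (`S1CoreCapSevenPlane`): `c = |unionL l| ∈ {5, …, 9}`, `f₀` fat
points in it, `costSum l ≥ c + f₀ − 3`. Inside the plane `3 · #l ≤ C(c, 2)` and a fat point of the plane lies on at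
most `(c − 1) / 2` of its lines (`sum_fat_plane_le`: the lines through it are disjoint off it), so the plane's cap is
`≤ C(c, 2) / 3 + f₀ · (c − 1) / 2`; outside, the lines form a thin family over the plane with budget
`b = 10 − c − f₀` on free lines and new fat points (`budget_over_plane'`), of cap `≤ b (b + 1) / 2 + f₀ b`
(`two_mul_sum_cap_thin_le`). The table over `(c, f₀)` with `c + f₀ ≤ 10` reads at most `19` (attained by the crude
count at `(5, 1)` and `(5, 2)`; the searches' maximum without big lines is `16`): `sum_cap_le_nineteen_of_no_big`.
`proofs/P1-S4-CAPBRIDGE.md` §18 (v). Axioms: standard.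
-/

namespace PercRepro

namespace S1

namespace FourCap

namespace Seven

variable {β : Type} [DecidableEq β]

/-! ### Fat points inside a plane -/

/-- **A fat point of a plane lies on at most `(c − 1) / 2` of its lines**, summed: for a duplicate-free list `l` of
3-point lines pairwise sharing at most one point, `Σ_{L ∈ l} fat L ≤ fat (unionL l) · ((|unionL l| − 1) / 2)`. -/
theorem sum_fat_plane_le (w : β → ℕ) (l : List (Finset β)) (h3 : ∀ L ∈ l, L.card = 3)
    (hpair : ∀ L ∈ l, ∀ L' ∈ l, L ≠ L' → (L ∩ L').card ≤ 1) :
    ∑ L ∈ l.toFinset, fat w L ≤ fat w (unionL l) * (((unionL l).card - 1) / 2) := by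
  set P₀ := unionL l with hP₀
  have hsub : ∀ L ∈ l.toFinset, L ⊆ P₀ := fun L hL v hv => mem_unionL_iff.2 ⟨L, List.mem_toFinset.1 hL, hv⟩
  -- double counting: `Σ_L fat L = Σ_{p fat} deg p`
  have hline : ∀ L ∈ l.toFinset, fat w L = ∑ p ∈ P₀.filter (fun u => w u = 2), if p ∈ L then 1 else 0 := by
    intro L hL
    unfold fat
    have e : L.filter (fun u => w u = 2) = (P₀.filter (fun u => w u = 2)).filter (fun p => p ∈ L) := by
      ext u
      simp only [Finset.mem_filter]
      exact ⟨fun h => ⟨⟨hsub L hL h.1, h.2⟩, h.1⟩, fun h => ⟨h.2, h.1.2⟩⟩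
    rw [e, Finset.card_filter]
  rw [Finset.sum_congr rfl hline, Finset.sum_comm]
  -- the degree of a point of the plane: the lines through `p` are disjoint off `p`
  have hdeg : ∀ p ∈ P₀.filter (fun u => w u = 2),
      (∑ L ∈ l.toFinset, if p ∈ L then 1 else 0) ≤ (P₀.card - 1) / 2 := by
    intro p hp
    have hpP : p ∈ P₀ := (Finset.mem_filter.1 hp).1
    rw [← Finset.card_filter]
    set D := l.toFinset.filter (fun L => p ∈ L) with hD
    have hDmem : ∀ L ∈ D, L ∈ l ∧ p ∈ L := fun L hL => by
      have h := Finset.mem_filter.1 hL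
      exact ⟨List.mem_toFinset.1 h.1, h.2⟩
    have hdisj : ∀ L ∈ D, ∀ L' ∈ D, L ≠ L' → Disjoint (L.erase p) (L'.erase p) := by
      intro L hL L' hL' hne
      rw [Finset.disjoint_left]
      intro u hu hu'
      have h1 := Finset.mem_erase.1 hu
      have h2 := Finset.mem_erase.1 hu'
      have hint := hpair L (hDmem L hL).1 L' (hDmem L' hL').1 hne
      exact h1.1 (Finset.card_le_one.1 hint u (Finset.mem_inter.2 ⟨h1.2, h2.2⟩) p
        (Finset.mem_inter.2 ⟨(hDmem L hL).2, (hDmem L' hL').2⟩))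
    have hcard := Finset.card_biUnion hdisj
    have hsum : ∑ L ∈ D, (L.erase p).card = 2 * D.card := by
      rw [Finset.sum_const_nat (m := 2) (fun L hL => by
        rw [Finset.card_erase_of_mem (hDmem L hL).2, h3 L (hDmem L hL).1])]
      ring
    have hsub' : D.biUnion (fun L => L.erase p) ⊆ P₀.erase p := by
      intro u hu
      obtain ⟨L, hL, hu⟩ := Finset.mem_biUnion.1 hu
      have h := Finset.mem_erase.1 hu
      exact Finset.mem_erase.2 ⟨h.1, hsub L (Finset.mem_filter.1 hL).1 h.2⟩
    have hle := Finset.card_le_card hsub'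
    rw [hcard, hsum, Finset.card_erase_of_mem hpP] at hle
    omega
  refine (Finset.sum_le_sum hdeg).trans ?_
  rw [Finset.sum_const_nat (m := (P₀.card - 1) / 2) (fun _ _ => rfl)]
  rfl

/-! ### The two cases -/

section NoBig

variable {w : β → ℕ} {ls : Finset (Finset β)}
  (h1 : ∀ L ∈ ls, ∀ v ∈ L, w v = 1 ∨ w v = 2)
  (h2 : ∀ L ∈ ls, 3 ≤ L.card ∧ wsum w L ≤ 5)
  (h3 : ∀ L ∈ ls, ∀ L' ∈ ls, L ≠ L' → (L ∩ L').card ≤ 1)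
  (h4 : ∀ l : List (Finset β), l.Nodup → (∀ L ∈ l, L ∈ ls) → wsum w (unionL l) ≤ 7 + lineRank l)
  (h5 : ∀ l : List (Finset β), l.Nodup → (∀ L ∈ l, L ∈ ls) → lineRank l ≤ 3 → (unionL l).card ≤ 9)

include h1 h2 h4 in
/-- **Pairwise disjoint lines: cap `≤ 7`** — every line is free in any order and every fat point is new once. -/
theorem sum_cap_le_seven_of_pairwise_disjoint (hall : ∀ L ∈ ls, L.card = 3)
    (hdisj : ∀ L ∈ ls, ∀ L' ∈ ls, L ≠ L' → (L ∩ L').card = 0) :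
    ∑ L ∈ ls, capPaper L.card (fat w L) ≤ 7 := by
  -- the full list is a free sequence
  have hfree : ∀ t : List (Finset β), t.Nodup → (∀ L ∈ t, L ∈ ls) → freeCountR ∅ t = t.length := by
    intro t
    induction t with
    | nil => intros; rfl
    | cons L t ih =>
      intro hnd hls
      have hL := hls L List.mem_cons_self
      have hsd : 0 < L.card := by rw [hall L hL]; omega
      obtain ⟨v, hv⟩ := Finset.card_pos.1 hsd
      rw [freeCountR_cons_of_new hv (Finset.notMem_empty v) (fun L' hL' hvL' => by
        have hne : L ≠ L' := fun h => (List.nodup_cons.1 hnd).1 (h ▸ hL')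
        have := hdisj L hL L' (hls L' (List.mem_cons_of_mem _ hL')) hne
        rw [Finset.card_eq_zero] at this
        exact Finset.notMem_empty v (this ▸ Finset.mem_inter.2 ⟨hv, hvL'⟩)),
        ih (List.nodup_cons.1 hnd).2 (fun L' hL' => hls L' (List.mem_cons_of_mem _ hL'))]
      rfl
  have hb := budget_of_prefix h1 (two_le_card_of_spec₇ h2) h4 [] ls.toList (by simpa using Finset.nodup_toList ls)
    (fun L hL => by simpa using hL) (fun L hL => hall L (Finset.mem_toList.1 hL))
  simp only [unionL, costSum, Nat.zero_add] at hb
  rw [hfree ls.toList (Finset.nodup_toList ls) (fun L hL => Finset.mem_toList.1 hL), Finset.length_toList] at hb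
  have hf0 : fat w (∅ : Finset β) = 0 := by simp [fat]
  -- the fat points of the union are the fat points of the lines, each on one line
  have hU : unionLR ∅ ls.toList = ls.biUnion id := by
    ext v
    simp only [mem_unionLR_iff, Finset.notMem_empty, false_or, Finset.mem_biUnion, Finset.mem_toList, id_eq]
  have hdisjf : ∀ L ∈ ls, ∀ L' ∈ ls, L ≠ L' →
      Disjoint (L.filter (fun u => w u = 2)) (L'.filter (fun u => w u = 2)) := by
    intro L hL L' hL' hne
    rw [Finset.disjoint_left]
    intro u hu hu'
    have := hdisj L hL L' hL' hne
    rw [Finset.card_eq_zero] at this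
    exact Finset.notMem_empty u (this ▸ Finset.mem_inter.2 ⟨(Finset.mem_filter.1 hu).1, (Finset.mem_filter.1 hu').1⟩)
  have hsumfat : ∑ L ∈ ls, fat w L = fat w (ls.biUnion id) := by
    unfold fat
    rw [← Finset.card_biUnion hdisjf]
    congr 1
    ext u
    simp only [Finset.mem_biUnion, Finset.mem_filter, id_eq]
    constructor
    · rintro ⟨L, hL, hu, h2⟩; exact ⟨⟨L, hL, hu⟩, h2⟩
    · rintro ⟨⟨L, hL, hu⟩, h2⟩; exact ⟨L, hL, hu, h2⟩
  have hcap : ∀ L ∈ ls, capPaper L.card (fat w L) = 1 + fat w L := by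
    intro L hL
    have := wsum_eq_card_add_fat w L (h1 L hL)
    have := (h2 L hL).2
    have := hall L hL
    rw [hall L hL, capPaper_three_eq' (by omega)]
  rw [Finset.sum_congr rfl hcap, Finset.sum_add_distrib, Finset.sum_const_nat (m := 1) (fun _ _ => rfl), hsumfat]
  rw [hU] at hb
  omega

include h1 h2 h4 in
/-- **The budget over a plane, with fat points**: a list `t` of 3-point lines of the configuration outside a list
`l` with `lineRank l ≤ 3` has `freeCountR (unionL l) t + fat (unionLR (unionL l) t ∖ unionL l) + |unionL l| +
fat (unionL l) ≤ 10`. -/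
theorem budget_over_plane' {l : List (Finset β)} (hr : lineRank l ≤ 3) (t : List (Finset β))
    (hnd : (t ++ l).Nodup) (hls : ∀ L ∈ t ++ l, L ∈ ls) (h3t : ∀ L ∈ t, L.card = 3) :
    freeCountR (unionL l) t + fat w (unionLR (unionL l) t \ unionL l) + (unionL l).card + fat w (unionL l) ≤ 10 := by
  have hb := budget_of_prefix h1 (two_le_card_of_spec₇ h2) h4 l t hnd hls h3t
  have hl : ∀ L ∈ l, L ∈ ls := fun L hL => hls L (List.mem_append_right _ hL)
  have hc := wsum_unionL_eq w l (fun L hL => h1 L (hl L hL)) (fun L hL => two_le_card_of_spec₇ h2 L (hl L hL))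
  rw [wsum_eq_card_add_fat w (unionL l) (fun v hv => by
    obtain ⟨L, hL, hvL⟩ := mem_unionL_iff.1 hv
    exact h1 L (hl L hL) v hvL)] at hc
  have hsplit := fat_sdiff_add_fat_of_subset w (subset_unionLR (unionL l) t)
  omega

include h1 h2 h3 h4 h5 in
/-- **No big line: cap sum `≤ 19`** — pairwise disjoint lines give `≤ 7`; otherwise the plane on two meeting
lines has `c ∈ {5, …, 9}` points and `f₀` fat points, cap `≤ C(c, 2)/3 + f₀ (c − 1)/2` inside and
`≤ b (b + 1)/2 + f₀ b` outside at budget `b = 10 − c − f₀`. -/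
theorem sum_cap_le_nineteen_of_no_big (hall : ∀ L ∈ ls, L.card = 3) :
    ∑ L ∈ ls, capPaper L.card (fat w L) ≤ 19 := by
  by_cases hmeet : ∃ L₁ ∈ ls, ∃ L₂ ∈ ls, L₂ ≠ L₁ ∧ (L₂ ∩ L₁).card = 1
  · obtain ⟨L₁, hL₁, L₂, hL₂, hne, hint⟩ := hmeet
    have h2' := two_le_card_of_spec₇ h2
    obtain ⟨l, hnd, hls, hr, hsub, hmax⟩ := exists_plane ls _ [L₂, L₁] le_rfl (by simp [hne])
      (by simp [hL₁, hL₂]) (by rw [lineRank_pair_eq_three (h2' L₁ hL₁) (h2' L₂ hL₂) hint])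
    have hc9 : (unionL l).card ≤ 9 := card_plane_le_nine h5 hnd hls hr
    have hc5 : 5 ≤ (unionL l).card := five_le_card_plane (h2 L₁ hL₁).1 (h2 L₂ hL₂).1 hint.le (hsub L₁ (by simp))
      (hsub L₂ (by simp))
    -- inside the plane
    have hin : 3 * l.length ≤ (unionL l).card.choose 2 := three_mul_length_le_choose_two l hnd
      (fun L hL => hall L (hls L hL)) (fun L hL L' hL' hne => h3 L (hls L hL) L' (hls L' hL') hne)
    have hfatin := sum_fat_plane_le w l (fun L hL => hall L (hls L hL))
      (fun L hL L' hL' hne => h3 L (hls L hL) L' (hls L' hL') hne)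
    -- outside the plane: a thin family
    set T := ls.filter (fun L => L ∉ l) with hT
    have hTmem : ∀ L ∈ T, L ∈ ls ∧ L ∉ l := fun L hL => Finset.mem_filter.1 hL
    have hk : ∀ t : List (Finset β), t.Nodup → (∀ L ∈ t, L ∈ T) →
        freeCountR (unionL l) t + fat w (unionLR (unionL l) t \ unionL l) ≤
          10 - (unionL l).card - fat w (unionL l) := by
      intro t hndt hlt
      have hb := budget_over_plane' h1 h2 h4 hr t (by
        rw [List.nodup_append']
        exact ⟨hndt, hnd, fun L hLt hLl => (hTmem L (hlt L hLt)).2 hLl⟩)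
        (fun L hL => by
          rcases List.mem_append.1 hL with hL | hL
          · exact (hTmem L (hlt L hL)).1
          · exact hls L hL)
        (fun L hL => hall L (hTmem L (hlt L hL)).1)
      omega
    have hthin := two_mul_sum_cap_thin_le w (unionL l) T
      (fun L hL => ⟨hall L (hTmem L hL).1, hmax L (hTmem L hL).1 (hTmem L hL).2⟩)
      (fun L hL L' hL' hne => h3 L (hTmem L hL).1 L' (hTmem L' hL').1 hne)
      (fun L hL => h1 L (hTmem L hL).1) (fun L hL => (h2 L (hTmem L hL).1).2) hk
    -- `c + f₀ ≤ 10`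
    have hcost : (unionL l).card + fat w (unionL l) ≤ 10 := by
      have := budget_over_plane' h1 h2 h4 hr [] (by simpa using hnd) (by simpa using hls) (by simp)
      omega
    -- the split of the sum
    have hsplit := Finset.sum_filter_add_sum_filter_not ls (fun L => L ∈ l) (fun L => capPaper L.card (fat w L))
    have hfil : ls.filter (fun L => L ∈ l) = l.toFinset := by
      ext L
      simp only [Finset.mem_filter, List.mem_toFinset]
      exact ⟨fun h => h.2, fun h => ⟨hls L h, h⟩⟩
    rw [hfil, ← hT] at hsplit
    rw [← hsplit]
    have hcapl : ∀ L ∈ l.toFinset, capPaper L.card (fat w L) = 1 + fat w L := by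
      intro L hL
      have hL' := hls L (List.mem_toFinset.1 hL)
      have := wsum_eq_card_add_fat w L (h1 L hL')
      have := (h2 L hL').2
      have := hall L hL'
      rw [hall L hL', capPaper_three_eq' (by omega)]
    rw [Finset.sum_congr rfl hcapl, Finset.sum_add_distrib, Finset.sum_const_nat (m := 1) (fun _ _ => rfl),
      List.toFinset_card_of_nodup hnd, Nat.mul_one]
    rw [Nat.choose_two_right] at hin
    -- the table
    generalize hc : (unionL l).card = c at hin hfatin hthin hcost hc5 hc9
    generalize hf : fat w (unionL l) = f₀ at hfatin hthin hcost
    generalize l.length = a at hin ⊢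
    generalize ∑ L ∈ l.toFinset, fat w L = b at hfatin ⊢
    generalize ∑ L ∈ T, capPaper L.card (fat w L) = d at hthin ⊢
    have hf5 : f₀ ≤ 5 := by omega
    interval_cases c <;> interval_cases f₀ <;> omega
  · push Not at hmeet
    refine (sum_cap_le_seven_of_pairwise_disjoint h1 h2 h4 hall (fun L hL L' hL' hne => ?_)).trans (by omega)
    rw [Finset.inter_comm]
    have := h3 L' hL' L hL hne.symm
    have := hmeet L hL L' hL' hne.symm
    omega

end NoBig

end Seven

end FourCap

end S1

end PercRepro
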